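import Summits.AtomisticToContinuum.BoseEinsteinCondensation.Theorems.BECInfraredBoundAssembly
import Summits.AtomisticToContinuum.BoseEinsteinCondensation.Theses.BECCutLineWeakDisorder

/-!
# Route `BECCutLineWeakDisorder`, assembly item `Assembly` (stmt-AtomisticToContinuum-9090)

Settles the assembly item `stmt-AtomisticToContinuum-9090` of route
`route-AtomisticToContinuum-BECCutLineWeakDisorder`: the implication

  `LandscapeBound → GroundStateRigidity → FlatModeFromLandscape → OccupationStability →
    ZeroModeOfLandscape → BoseEinsteinCondensation`

(the audited sub-problem abbrev `_root_.BoseEinsteinCondensation`, by name).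

The hypotheses of `Assembly` are, verbatim and in the same order, those of the route's deciding
theorem `closes`, so the assembly is that composition: the glue item `ZeroModeOfLandscape`
takes the four statements `LandscapeBound`, `GroundStateRigidity`, `FlatModeFromLandscape`,
`OccupationStability` to the flat-mode occupation thesis `X_B1`
(`AtomisticToContinuum.BECInfraredBound.BecZeroModeThesis`: flat-mode occupation `≥ c N` for all
`δ`-near-minimisers at small density), and the tree theorem
`AtomisticToContinuum.BECInfraredBound.bec_of_zeroMode` (proved in
`Theorems/BECInfraredBoundAssembly.lean`) takes `X_B1` to the conjunct.
Pure logic; no analytic content lives here — the composition is spelled out (rather than citing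
`closes`) so that this file depends only on the item statements and the proved tree theorem.

References: [LSSY2005, §1.2 and Ch. 5] (the conjunct being assembled), [PenroseOnsager1956]
(the one-mode occupation criterion behind `X_B1`).
-/

namespace Summit.AtomisticToContinuum.BoseEinsteinCondensation.Theorems

/-- **Item stmt-AtomisticToContinuum-9090** (`Assembly` of route `BECCutLineWeakDisorder`, exact
route decl): given `hL : LandscapeBound`, `hR : GroundStateRigidity`, `hF : FlatModeFromLandscape`,
`hO : OccupationStability` and the glue `hZ : ZeroModeOfLandscape`, the term `hZ hL hR hF hO` is the
flat-mode occupation thesis `BecZeroModeThesis`, which the proved tree theorem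
`AtomisticToContinuum.BECInfraredBound.bec_of_zeroMode` turns into `BoseEinsteinCondensation`.
Pure composition of the route's hypotheses (the route's deciding theorem `closes`, curried).
[folklore] -/
theorem becCutLineWeakDisorder_assembly_proof :
    Summit.AtomisticToContinuum.BoseEinsteinCondensation.Theses.BECCutLineWeakDisorder.Assembly := by
  unfold Theses.BECCutLineWeakDisorder.Assembly
  intro hL hR hF hO hZ
  exact _root_.AtomisticToContinuum.BECInfraredBound.bec_of_zeroMode (hZ hL hR hF hO)

end Summit.AtomisticToContinuum.BoseEinsteinCondensation.Theorems
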